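import Summits.BirchSwinnertonDyer.BirchSwinnertonDyer.Theses.PrintX8VS
import Summits.BirchSwinnertonDyer.BirchSwinnertonDyer.Theses.PrintX8
import Summits.BirchSwinnertonDyer.BirchSwinnertonDyer.Theorems.PrintX8VSInputHondaSystemPrimalPadic
import Summits.BirchSwinnertonDyer.BirchSwinnertonDyer.Theorems.PrintX8VSInputHondaSystemPrimalTransport
import Summits.BirchSwinnertonDyer.BirchSwinnertonDyer.Theorems.PrintX8VSInputHondaSystemDualClauses
import HarnessLib

/-!
# `InputHondaSystem` (routes `PrintX8VS`, `PrintX8`; item stmt-BirchSwinnertonDyer-20413): Sprung 2012, Theorem 2.2 — the named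
# fact `Literature.NumberTheory.EllipticCurves.Sprung2012.thm22_exists_isHondaSystem` PROVED (file 18, the closing file of the
# local series `PrintX8VSInputHondaSystem*`)

HONEST FRAMING (desk `pub/bsd-wall/bsd-inputs`, seat `bsd-inputs-honda-p1`, D-0154 (2) INPUTS): this file discharges ONE published
INPUT of the printed-inputs routes — the existence of a Honda system of local points along the cyclotomic `ℤ_p`-tower at an odd
supersingular prime (Sprung 2012 Thm. 2.2 / Kobayashi 2003 §8), in the tree's `ℤ_p`-tower form `Sprung2012.IsHondaSystem`. It is an
unconditional theorem about elliptic curves over `ℚ`; it closes the support item `InputHondaSystem` and NOTHING ELSE: the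
Birch–Swinnerton-Dyer conjecture is NOT proved by any of this, nor is any crux of the routes.

## Proof (files 1–17)

For `W/ℚ` globally minimal, `p` odd of good reduction with `p ∣ a_p`: a `ℤ_p`-model `M` with `Δ ∈ ℤ_pˣ` and Hasse coefficient in `𝔪`
(`…PadicModel`); the Sprung sequence `x` and the logarithm `log_{F_ss} = ∑_k x_k((1+X)^{pᵏ} − 1)/…` of Honda type `t² − a_p t + p`
(`…SprungLog`, `…SprungLogValues`); an integral isomorphism `F_ss ≅ Ê` (`…SprungHondaIso`); the Honda points `c_m ∈ Ê(ℚ_p(ζ_{p^m}))`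
with `log c_m = ℓ_m` and Kobayashi's generation step (`…SprungTowerPoints/Generation/Relations`); the rescaled `Δ`-descent to the
`ℤ_p`-layers with the three trace relations and `ℤ[Γ]`-generation (`…LayerGalois`, `…LocalTraces/Relations/Generation`,
`…PrimalPadic`); model transport `ℚ_[p] → ℚ_v` (`…PrimalTransport`); and the passage to the DUAL generation clauses of
`IsHondaSystem` (`…OmegaDivisibility`, `…DualCore`, `…DualClauses`).

References: [Sprung2012] F. Sprung, J. Number Theory 132 (2012), Thm. 2.2 (p. 1487), Cor. 2.10, Lemmas 7.4–7.5; [Kobayashi2003]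
S. Kobayashi, Invent. Math. 152 (2003), §8.
-/

set_option autoImplicit false
-- the Theorems namespace of this sub repeats the summit name by design (D-0017 nested layout)
set_option linter.dupNamespace false

noncomputable section

open scoped Classical NumberField

open NumberField IsDedekindDomain Literature.NumberTheory.EllipticCurves Literature.NumberTheory.GaloisRepresentations
  Literature.NumberTheory.EllipticCurves.Kobayashi2003 Literature.NumberTheory.EllipticCurves.Sprung2012

namespace Summit.BirchSwinnertonDyer.BirchSwinnertonDyer.Theorems

/-- **Sprung 2012, Theorem 2.2 (named fact `Sprung2012.thm22_exists_isHondaSystem`) — PROVED.** For `W/ℚ` elliptic and globally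
minimal, `p ≠ 2` of good reduction with `p ∣ a_p`, a cyclotomic `κ` with topological generator `γ`, the place `v ∋ p` and a local
lift `g` of the generator: there are `cneg = c_{−1} ∈ E(ℚ_v)` and `c = (c_n)_n` with `IsHondaSystem κ (closureEmb ℚ_v) W a_p g cneg c`.
[cite: Sprung2012, Thm. 2.2 (p. 1487), Cor. 2.10 (p. 1489)] [cite: Kobayashi2003, Lemma 8.9, Prop. 8.11, Prop. 8.12] -/
theorem thm22_exists_isHondaSystem_holds : Literature.NumberTheory.EllipticCurves.Sprung2012.thm22_exists_isHondaSystem := by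
  intro W _ _ p _ hp2 hgood hap κ γ hκ _ _ v hv g hg
  obtain ⟨cneg, c, N, hN, hcneg, hc, hR0, hR1, hRn, hGEN, hGEN0⟩ :=
    SprungHonda.primalHonda_adicCompletion_of_padic W κ (W.frobeniusTrace p) v hv
      (fun ι ↦ SprungHonda.exists_primalHonda_padic W hp2 hgood hap κ hκ ι)
  exact ⟨cneg, c, SprungHonda.isHondaSystem_of_primal κ (closureEmb (K := ℚ) (v.adicCompletion ℚ)) W
    (SprungHonda.intCast_sub_two_isUnit_of_dvd hp2 hap).2 hg hN hcneg hc hR0 hR1 hRn hGEN hGEN0⟩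

/-- **`InputHondaSystem` of route `PrintX8VS`** (item stmt-BirchSwinnertonDyer-20413): the route declaration is by definition the
named fact `Sprung2012.thm22_exists_isHondaSystem`, proved above. BSD is not proved by this. [cite: Sprung2012, Thm. 2.2 (p. 1487)] -/
theorem InputHondaSystem_proof : Summit.BirchSwinnertonDyer.BirchSwinnertonDyer.Theses.PrintX8VS.InputHondaSystem := by
  unfold Summit.BirchSwinnertonDyer.BirchSwinnertonDyer.Theses.PrintX8VS.InputHondaSystem
  exact thm22_exists_isHondaSystem_holds

/-- **`InputHondaSystem` of route `PrintX8`** (the same item): again by definition the named fact. BSD is not proved by this.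
[cite: Sprung2012, Thm. 2.2 (p. 1487)] -/
theorem PrintX8_InputHondaSystem_proof : Summit.BirchSwinnertonDyer.BirchSwinnertonDyer.Theses.PrintX8.InputHondaSystem := by
  unfold Summit.BirchSwinnertonDyer.BirchSwinnertonDyer.Theses.PrintX8.InputHondaSystem
  exact thm22_exists_isHondaSystem_holds

end Summit.BirchSwinnertonDyer.BirchSwinnertonDyer.Theorems

end
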